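import Literature.NumberTheory.LFunctions.SelbergClassThinSetPrimeSums
import Literature.NumberTheory.LFunctions.SelbergClassProofs
import Mathlib.Analysis.SpecialFunctions.Gamma.Digamma
import Mathlib.Analysis.Calculus.Deriv.Star
import HarnessLib

/-!
# Strong multiplicity one for the Selberg class: the logarithmic derivative of `Φ_F/Φ_G`

Layer 4 of the formalisation of K. Soundararajan, *Strong multiplicity one for the Selberg class*,
Canad. Math. Bull. 47 (2004) 468–474 = arXiv:math/0210299 (named fact
`Literature.NumberTheory.LFunctions.Soundararajan2004_strongMultiplicityOne_thinSet`). Pure proof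
file (theorems only).

This is the analytic content of the paragraph of p. 1 following (4): with `c(n) = b_F(n) − b_G(n)`
and `E(s) = ∑ c(n) n^{-s}` (absolutely convergent on `re s > 1/2` by
`SelbergClassThinSetPrimeSums.lean`),

* `SelbergDatum.differentiableAt_toFun`, `analyticOnNhd_toFun`, `analyticOnNhd_completed`,
  `differentiableOn_gammaFactor`, `gammaFactor_ne_zero` — regularity of `F`, `Φ = γ F`, `γ`;
* `SelbergDatum.logDeriv_completed` — `Φ'/Φ = log Q + ∑ⱼ λⱼ ψ(λⱼ s + μⱼ) + F'/F` (`re s > 0`);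
* `SelbergDatum.logDeriv_completed_eq_neg_conj` — the functional equation differentiated:
  `Φ'/Φ(s) = −conj Φ'/Φ(1 − s̄)` on the open critical strip;
* `Soundararajan2004.toFun_eq_mul_exp` — **`F = G · e^{E}` on `re s > 1/2`, `s ≠ 1`** (identity
  theorem): the formal version of "the zeros of `F` and `G` in this region coincide (including
  multiplicities), and … `m_F = m_G`";
* `Soundararajan2004.logDeriv_toFun_sub`, `logDeriv_completed_sub` — hence
  `Φ_F'/Φ_F − Φ_G'/Φ_G = log(Q_F/Q_G) + (Γ-terms) − ∑ c(n) log n n^{-s}` to the right of the line;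
* `Soundararajan2004.analyticOrderAt_conj_comp_one_sub_conj` — orders of zeros are preserved by
  `s ↦ 1 − s̄`;
* `Soundararajan2004.analyticOrderAt_completed_eq`, `meromorphicOrderAt_completed_eq` — **the zeros of
  `Φ_F` and `Φ_G` off the critical line coincide with multiplicities** (right half: unit multiple;
  left half: functional equation).

## References

* K. Soundararajan, *Strong multiplicity one for the Selberg class*, Canad. Math. Bull. 47 (2004)
  468–474; arXiv:math/0210299, p. 1, display (4) and the paragraph following it. [Soundararajan2002]
-/

noncomputable section

open Complex Filter Topology Set Asymptotics
open scoped ComplexConjugate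

namespace Literature.NumberTheory.LFunctions

namespace SelbergDatum

variable (D : SelbergDatum)

/-- `F` is differentiable at every `s ≠ 1` (continuation axiom: `F(z) = G(z)/(z-1)^m` near `s`
with `G` entire). [folklore] -/
theorem differentiableAt_toFun {s : ℂ} (hs : s ≠ 1) : DifferentiableAt ℂ D.toFun s := by
  obtain ⟨G, hG, hGF⟩ := D.differentiable
  have hev : (fun z ↦ G z / (z - 1) ^ D.polarOrder) =ᶠ[𝓝 s] D.toFun := by
    filter_upwards [isOpen_ne.mem_nhds hs] with z hz
    rw [hGF z hz, mul_div_cancel_left₀ _ (pow_ne_zero _ (sub_ne_zero.mpr hz))]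
  refine DifferentiableAt.congr_of_eventuallyEq ?_ hev.symm
  exact (hG s).div (by fun_prop) (pow_ne_zero _ (sub_ne_zero.mpr hs))

/-- `F` is analytic on `ℂ ∖ {1}`. [folklore] -/
theorem analyticOnNhd_toFun : AnalyticOnNhd ℂ D.toFun {s : ℂ | s ≠ 1} :=
  DifferentiableOn.analyticOnNhd (fun _ hs ↦ (D.differentiableAt_toFun hs).differentiableWithinAt)
    isOpen_ne

/-- The completed function `Φ` is analytic on `{0 < re s} ∖ {1}`. [folklore] -/
theorem analyticOnNhd_completed : AnalyticOnNhd ℂ D.completed {s : ℂ | 0 < s.re ∧ s ≠ 1} :=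
  D.differentiableOn_completed_holds.analyticOnNhd
    ((isOpen_lt continuous_const continuous_re).inter isOpen_ne)

/-- **Logarithmic derivative of the completed function**: for `re s > 0`, `s ≠ 1`, `F(s) ≠ 0`,
`Φ'/Φ(s) = log Q + ∑ⱼ λⱼ ψ(λⱼ s + μⱼ) + F'/F(s)` (`ψ = Γ'/Γ`). [folklore] -/
theorem logDeriv_completed {s : ℂ} (hs : 0 < s.re) (hs1 : s ≠ 1) (hF : D.toFun s ≠ 0) :
    logDeriv D.completed s =
      Complex.log D.Q + ∑ j, (D.lam j : ℂ) * digamma (D.lam j * s + D.mu j) + logDeriv D.toFun s := by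
  have hQ : (D.Q : ℂ) ≠ 0 := D.Q_ne_zero
  have hΓ : ∀ j, Gamma (D.lam j * s + D.mu j) ≠ 0 := fun j ↦ D.Gamma_lam_mul_add_mu_ne_zero s hs j
  have hΓd : ∀ j, DifferentiableAt ℂ Gamma (D.lam j * s + D.mu j) := by
    intro j
    refine differentiableAt_Gamma _ fun m h ↦ ?_
    have := congrArg Complex.re h
    rw [re_lam_mul_add] at this
    have h1 := D.lam_pos j; have h2 := D.mu_re_nonneg j
    simp at this
    nlinarith
  -- the three factors
  have h1 : logDeriv (fun z : ℂ ↦ (D.Q : ℂ) ^ z) s = Complex.log D.Q := by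
    rw [logDeriv_apply, ((hasStrictDerivAt_const_cpow (Or.inl hQ)).hasDerivAt).deriv,
      mul_div_cancel_left₀ _ (cpow_ne_zero_iff_of_exponent_ne_zero ?_ |>.mpr hQ)]
    · rintro rfl; simp at hs
  have h2 : ∀ j, logDeriv (fun z : ℂ ↦ Gamma (D.lam j * z + D.mu j)) s =
      (D.lam j : ℂ) * digamma (D.lam j * s + D.mu j) := by
    intro j
    have hcomp := logDeriv_comp (f := Gamma) (g := fun z : ℂ ↦ (D.lam j : ℂ) * z + D.mu j) (x := s)
      (hΓd j) (by fun_prop)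
    rw [Function.comp_def] at hcomp
    have hd : deriv (fun z : ℂ ↦ (D.lam j : ℂ) * z + D.mu j) s = D.lam j := by
      rw [deriv_add_const, deriv_const_mul _ differentiableAt_id]
      simp
    rw [hcomp, digamma_def, hd, mul_comm]
  have h3 : logDeriv (fun z : ℂ ↦ ∏ j, Gamma (D.lam j * z + D.mu j)) s =
      ∑ j, (D.lam j : ℂ) * digamma (D.lam j * s + D.mu j) := by
    rw [logDeriv_prod (fun j _ ↦ hΓ j) (fun j _ ↦ (hΓd j).comp s (by fun_prop))]
    exact Finset.sum_congr rfl fun j _ ↦ h2 j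
  have hprod_ne : ∏ j, Gamma (D.lam j * s + D.mu j) ≠ 0 := Finset.prod_ne_zero_iff.mpr fun j _ ↦ hΓ j
  have hcpow_ne : (D.Q : ℂ) ^ s ≠ 0 := cpow_ne_zero_iff_of_exponent_ne_zero (by rintro rfl; simp at hs) |>.mpr hQ
  have hdQ : DifferentiableAt ℂ (fun z : ℂ ↦ (D.Q : ℂ) ^ z) s :=
    (hasStrictDerivAt_const_cpow (Or.inl hQ)).hasDerivAt.differentiableAt
  have hdP : DifferentiableAt ℂ (fun z : ℂ ↦ ∏ j, Gamma (D.lam j * z + D.mu j)) s := by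
    have : (fun z : ℂ ↦ ∏ j, Gamma (D.lam j * z + D.mu j)) = ∏ j, fun z : ℂ ↦ Gamma (D.lam j * z + D.mu j) := by
      funext z; simp [Finset.prod_apply]
    rw [this]
    exact DifferentiableAt.finsetProd fun j _ ↦ (hΓd j).comp s (by fun_prop)
  have hdF : DifferentiableAt ℂ D.toFun s := D.differentiableAt_toFun hs1
  -- `completed = (Q^s · ∏ Γ) · F`
  have hc : D.completed = fun z ↦ ((D.Q : ℂ) ^ z * ∏ j, Gamma (D.lam j * z + D.mu j)) * D.toFun z := by
    funext z; rfl
  rw [hc, logDeriv_mul (f := fun z ↦ (D.Q : ℂ) ^ z * ∏ j, Gamma (D.lam j * z + D.mu j))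
      (g := D.toFun) s (mul_ne_zero hcpow_ne hprod_ne) hF (hdQ.mul hdP) hdF,
    logDeriv_mul (f := fun z : ℂ ↦ (D.Q : ℂ) ^ z) (g := fun z ↦ ∏ j, Gamma (D.lam j * z + D.mu j))
      s hcpow_ne hprod_ne hdQ hdP, h1, h3]

/-- **The functional equation for `Φ'/Φ`**: on the open critical strip, wherever `Φ(s) ≠ 0`,
`Φ'/Φ(s) = −conj (Φ'/Φ(1 − s̄))` (differentiate `Φ(s) = ω conj Φ(1 − s̄)`). [folklore] -/
theorem logDeriv_completed_eq_neg_conj {s : ℂ} (hs₀ : 0 < s.re) (hs₁ : s.re < 1) :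
    logDeriv D.completed s = -conj (logDeriv D.completed (1 - conj s)) := by
  -- `k(w) = Φ(1 - w)`, `g = conj ∘ k ∘ conj`, so that `Φ = ω g` on the strip
  set k : ℂ → ℂ := fun w ↦ D.completed (1 - w) with hk
  set g : ℂ → ℂ := conj ∘ k ∘ conj with hg
  have hstrip : IsOpen {z : ℂ | 0 < z.re ∧ z.re < 1} :=
    (isOpen_lt continuous_const continuous_re).inter (isOpen_lt continuous_re continuous_const)
  have hmem : s ∈ {z : ℂ | 0 < z.re ∧ z.re < 1} := ⟨hs₀, hs₁⟩
  have hFE : D.completed =ᶠ[𝓝 s] fun z ↦ D.rootNumber * g z := by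
    filter_upwards [hstrip.mem_nhds hmem] with z hz
    simpa [hg, hk] using D.completed_eq z hz.1 hz.2
  -- differentiability of `Φ` at `1 - conj s`
  have hs' : 0 < (1 - conj s).re ∧ (1 - conj s) ≠ 1 := by
    refine ⟨by simp; linarith, fun h ↦ ?_⟩
    have := congrArg Complex.re h
    simp at this
    linarith
  have hΦd : DifferentiableAt ℂ D.completed (1 - conj s) :=
    (D.analyticOnNhd_completed _ hs').differentiableAt
  have hkd : HasDerivAt k (-deriv D.completed (1 - conj s)) (conj s) := by
    have h1 : HasDerivAt (fun w : ℂ ↦ 1 - w) (-1) (conj s) := by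
      simpa using (hasDerivAt_id (conj s)).const_sub 1
    have := hΦd.hasDerivAt.comp (conj s) h1
    simpa [hk, Function.comp_def] using this
  have hgd : HasDerivAt g (conj (-deriv D.completed (1 - conj s))) s := by
    have := hkd.conj_conj
    rwa [conj_conj] at this
  -- logarithmic derivatives
  have hdΦ : deriv D.completed s = D.rootNumber * deriv g s := by
    rw [hFE.deriv_eq, deriv_const_mul _ hgd.differentiableAt]
  have hvΦ : D.completed s = D.rootNumber * g s := hFE.eq_of_nhds
  rw [logDeriv_apply, logDeriv_apply, hdΦ, hvΦ, hgd.deriv]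
  simp only [hg, hk, Function.comp_apply, map_neg, map_div₀]
  rw [mul_div_mul_left _ _ D.rootNumber_ne_zero]
  ring

end SelbergDatum

namespace Soundararajan2004

section Pair

variable {D₁ D₂ : SelbergDatum} {b₁ b₂ : ℕ → ℂ} {θ₁ θ₂ : ℝ} {𝓔 : Set ℕ} {δ₀ C : ℝ}

/-- The Dirichlet series `∑ c(n) n^{-s}`, `c = b_F − b_G`, converges absolutely on `re s > 1/2`
(its `log`-weighted version does, `LSeriesSummable_logMul_diff`). [cite: Soundararajan2002, p. 1] -/
theorem abscissaOfAbsConv_diff_le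
    (hb₁ : ∀ n, ¬ IsPrimePow n → b₁ n = 0) (hO₁ : b₁ =O[atTop] fun n ↦ (n : ℝ) ^ θ₁)
    (hexp₁ : ∀ s : ℂ, 1 < s.re → cexp (LSeries b₁ s) = D₁.toFun s)
    (hb₂ : ∀ n, ¬ IsPrimePow n → b₂ n = 0) (hO₂ : b₂ =O[atTop] fun n ↦ (n : ℝ) ^ θ₂)
    (hexp₂ : ∀ s : ℂ, 1 < s.re → cexp (LSeries b₂ s) = D₂.toFun s)
    (hθ₁ : θ₁ < 1 / 2) (hθ₂ : θ₂ < 1 / 2) (hδ : 0 < δ₀)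
    (hthin : ∀ x : ℝ, 2 ≤ x →
      (Set.ncard {p : ℕ | p ∈ 𝓔 ∧ p.Prime ∧ (p : ℝ) ≤ x} : ℝ) ≤ C * x ^ (1 / 2 - δ₀))
    (hagree : ∀ p : ℕ, p.Prime → p ∉ 𝓔 → D₁.coeff p = D₂.coeff p) :
    LSeries.abscissaOfAbsConv (b₁ - b₂) ≤ (1 / 2 : ℝ) := by
  rw [← LSeries.abscissaOfAbsConv_logMul]
  exact LSeries.abscissaOfAbsConv_le_of_forall_lt_LSeriesSummable fun y hy ↦
    LSeriesSummable_logMul_diff hb₁ hO₁ hexp₁ hb₂ hO₂ hexp₂ hθ₁ hθ₂ hδ hthin hagree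
      (by simpa using hy)

/-- On `re s > 1`: `F(s) = G(s) · exp (∑ c(n) n^{-s})` (axiom (v) for both data).
[cite: Soundararajan2002, p. 1] -/
theorem toFun_eq_mul_exp_of_one_lt_re
    (hb₁ : ∀ n, ¬ IsPrimePow n → b₁ n = 0) (hO₁ : b₁ =O[atTop] fun n ↦ (n : ℝ) ^ θ₁)
    (hexp₁ : ∀ s : ℂ, 1 < s.re → cexp (LSeries b₁ s) = D₁.toFun s)
    (hb₂ : ∀ n, ¬ IsPrimePow n → b₂ n = 0) (hO₂ : b₂ =O[atTop] fun n ↦ (n : ℝ) ^ θ₂)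
    (hexp₂ : ∀ s : ℂ, 1 < s.re → cexp (LSeries b₂ s) = D₂.toFun s)
    {s : ℂ} (hs : 1 < s.re) :
    D₁.toFun s = D₂.toFun s * cexp (LSeries (b₁ - b₂) s) := by
  rw [← hexp₁ s hs, ← hexp₂ s hs, ← Complex.exp_add,
    LSeries_sub (D₁.LSeriesSummable_euler hb₁ hO₁ hexp₁ hs) (D₂.LSeriesSummable_euler hb₂ hO₂ hexp₂ hs)]
  ring_nf

/-- **`F = G · e^{E}` to the right of the critical line** (`E(s) = ∑ c(n) n^{-s}`): the identity of
the previous lemma persists on `re s > 1/2`, `s ≠ 1`, by analytic continuation (with `Gᵢ` entire,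
`Gᵢ = (s-1)^{mᵢ} Fᵢ` off `1`, both sides of `(s-1)^{m₂} G₁ = (s-1)^{m₁} G₂ e^{E}` are analytic on the
half-plane). This is the formal content of "the zeros of `F` and `G` in this region coincide
(including multiplicities), and … `m_F = m_G`" (p. 1). [cite: Soundararajan2002, p. 1] -/
theorem toFun_eq_mul_exp
    (hb₁ : ∀ n, ¬ IsPrimePow n → b₁ n = 0) (hO₁ : b₁ =O[atTop] fun n ↦ (n : ℝ) ^ θ₁)
    (hexp₁ : ∀ s : ℂ, 1 < s.re → cexp (LSeries b₁ s) = D₁.toFun s)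
    (hb₂ : ∀ n, ¬ IsPrimePow n → b₂ n = 0) (hO₂ : b₂ =O[atTop] fun n ↦ (n : ℝ) ^ θ₂)
    (hexp₂ : ∀ s : ℂ, 1 < s.re → cexp (LSeries b₂ s) = D₂.toFun s)
    (hθ₁ : θ₁ < 1 / 2) (hθ₂ : θ₂ < 1 / 2) (hδ : 0 < δ₀)
    (hthin : ∀ x : ℝ, 2 ≤ x →
      (Set.ncard {p : ℕ | p ∈ 𝓔 ∧ p.Prime ∧ (p : ℝ) ≤ x} : ℝ) ≤ C * x ^ (1 / 2 - δ₀))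
    (hagree : ∀ p : ℕ, p.Prime → p ∉ 𝓔 → D₁.coeff p = D₂.coeff p)
    {s : ℂ} (hs : 1 / 2 < s.re) (hs1 : s ≠ 1) :
    D₁.toFun s = D₂.toFun s * cexp (LSeries (b₁ - b₂) s) := by
  have hab := abscissaOfAbsConv_diff_le hb₁ hO₁ hexp₁ hb₂ hO₂ hexp₂ hθ₁ hθ₂ hδ hthin hagree
  obtain ⟨G₁, hG₁, hG₁F⟩ := D₁.differentiable
  obtain ⟨G₂, hG₂, hG₂F⟩ := D₂.differentiable
  set U : Set ℂ := {z : ℂ | 1 / 2 < z.re} with hU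
  have hUo : IsOpen U := isOpen_lt continuous_const continuous_re
  have hEan : AnalyticOnNhd ℂ (fun z ↦ cexp (LSeries (b₁ - b₂) z)) U := by
    refine ((LSeries_analyticOnNhd (b₁ - b₂)).mono fun z hz ↦ ?_).cexp
    exact hab.trans_lt (by exact_mod_cast hz)
  set H : ℂ → ℂ := fun z ↦ (z - 1) ^ D₂.polarOrder * G₁ z -
      (z - 1) ^ D₁.polarOrder * G₂ z * cexp (LSeries (b₁ - b₂) z) with hH
  have hHan : AnalyticOnNhd ℂ H U := by
    have h1 : AnalyticOnNhd ℂ G₁ U := (hG₁.differentiableOn.analyticOnNhd isOpen_univ).mono (subset_univ _)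
    have h2 : AnalyticOnNhd ℂ G₂ U := (hG₂.differentiableOn.analyticOnNhd isOpen_univ).mono (subset_univ _)
    have hp : ∀ n : ℕ, AnalyticOnNhd ℂ (fun z : ℂ ↦ (z - 1) ^ n) U := fun n ↦
      ((analyticOnNhd_id.sub analyticOnNhd_const).pow n)
    exact ((hp _).mul h1).sub (((hp _).mul h2).mul hEan)
  have hH0 : H =ᶠ[𝓝 (2 : ℂ)] 0 := by
    have hopen : IsOpen {z : ℂ | 1 < z.re} := isOpen_lt continuous_const continuous_re
    filter_upwards [hopen.mem_nhds (show (2 : ℂ) ∈ {z : ℂ | 1 < z.re} by simp)] with z hz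
    have hz1 : z ≠ 1 := by rintro rfl; simp at hz
    have key := toFun_eq_mul_exp_of_one_lt_re hb₁ hO₁ hexp₁ hb₂ hO₂ hexp₂ hz
    simp only [hH, hG₁F z hz1, hG₂F z hz1, Pi.zero_apply]
    rw [key]; ring
  have h2U : (2 : ℂ) ∈ U := by simp [hU]; norm_num
  have hHs := hHan.eqOn_zero_of_preconnected_of_eventuallyEq_zero
    (convex_halfSpace_re_gt (1 / 2 : ℝ)).isPreconnected h2U hH0 (show s ∈ U from hs)
  simp only [hH, hG₁F s hs1, hG₂F s hs1, Pi.zero_apply] at hHs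
  have hs1' : (s - 1) ≠ 0 := sub_ne_zero.mpr hs1
  have key : (s - 1) ^ D₂.polarOrder * (s - 1) ^ D₁.polarOrder *
      (D₁.toFun s - D₂.toFun s * cexp (LSeries (b₁ - b₂) s)) = 0 := by
    rw [← hHs]; ring
  rcases mul_eq_zero.mp key with h' | h'
  · exact absurd h' (mul_ne_zero (pow_ne_zero _ hs1') (pow_ne_zero _ hs1'))
  · exact sub_eq_zero.mp h'

/-- **`F'/F − G'/G = −∑ c(n) log n · n^{-s}` to the right of the critical line** (p. 1, the
continuation of (4)): for `re s > 1/2`, `s ≠ 1` and `G(s) ≠ 0` one has `F(s) ≠ 0` and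
`F'/F(s) − G'/G(s) = −∑ c(n) log n n^{-s}`. [cite: Soundararajan2002, (4)] -/
theorem logDeriv_toFun_sub
    (hb₁ : ∀ n, ¬ IsPrimePow n → b₁ n = 0) (hO₁ : b₁ =O[atTop] fun n ↦ (n : ℝ) ^ θ₁)
    (hexp₁ : ∀ s : ℂ, 1 < s.re → cexp (LSeries b₁ s) = D₁.toFun s)
    (hb₂ : ∀ n, ¬ IsPrimePow n → b₂ n = 0) (hO₂ : b₂ =O[atTop] fun n ↦ (n : ℝ) ^ θ₂)
    (hexp₂ : ∀ s : ℂ, 1 < s.re → cexp (LSeries b₂ s) = D₂.toFun s)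
    (hθ₁ : θ₁ < 1 / 2) (hθ₂ : θ₂ < 1 / 2) (hδ : 0 < δ₀)
    (hthin : ∀ x : ℝ, 2 ≤ x →
      (Set.ncard {p : ℕ | p ∈ 𝓔 ∧ p.Prime ∧ (p : ℝ) ≤ x} : ℝ) ≤ C * x ^ (1 / 2 - δ₀))
    (hagree : ∀ p : ℕ, p.Prime → p ∉ 𝓔 → D₁.coeff p = D₂.coeff p)
    {s : ℂ} (hs : 1 / 2 < s.re) (hs1 : s ≠ 1) (hG : D₂.toFun s ≠ 0) :
    D₁.toFun s ≠ 0 ∧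
      logDeriv D₁.toFun s - logDeriv D₂.toFun s = -LSeries (LSeries.logMul (b₁ - b₂)) s := by
  have hab := abscissaOfAbsConv_diff_le hb₁ hO₁ hexp₁ hb₂ hO₂ hexp₂ hθ₁ hθ₂ hδ hthin hagree
  have habs : LSeries.abscissaOfAbsConv (b₁ - b₂) < s.re := hab.trans_lt (by exact_mod_cast hs)
  have hopen : IsOpen {z : ℂ | 1 / 2 < z.re ∧ z ≠ 1} :=
    (isOpen_lt continuous_const continuous_re).inter isOpen_ne
  have hev : D₁.toFun =ᶠ[𝓝 s] fun z ↦ D₂.toFun z * cexp (LSeries (b₁ - b₂) z) := by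
    filter_upwards [hopen.mem_nhds ⟨hs, hs1⟩] with z hz
    exact toFun_eq_mul_exp hb₁ hO₁ hexp₁ hb₂ hO₂ hexp₂ hθ₁ hθ₂ hδ hthin hagree hz.1 hz.2
  have hval := hev.eq_of_nhds
  have hF : D₁.toFun s ≠ 0 := by rw [hval]; exact mul_ne_zero hG (Complex.exp_ne_zero _)
  refine ⟨hF, ?_⟩
  have hE : HasDerivAt (fun z ↦ cexp (LSeries (b₁ - b₂) z))
      (cexp (LSeries (b₁ - b₂) s) * -LSeries (LSeries.logMul (b₁ - b₂)) s) s :=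
    (LSeries_hasDerivAt habs).cexp
  have hlogE : logDeriv (fun z ↦ cexp (LSeries (b₁ - b₂) z)) s = -LSeries (LSeries.logMul (b₁ - b₂)) s := by
    rw [logDeriv_apply, hE.deriv, mul_div_cancel_left₀ _ (Complex.exp_ne_zero _)]
  have h1 : logDeriv D₁.toFun s = logDeriv (fun z ↦ D₂.toFun z * cexp (LSeries (b₁ - b₂) z)) s := by
    rw [logDeriv_apply, logDeriv_apply, hev.deriv_eq, hval]
  rw [h1, logDeriv_mul (f := D₂.toFun) (g := fun z ↦ cexp (LSeries (b₁ - b₂) z)) s hG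
      (Complex.exp_ne_zero _) (D₂.differentiableAt_toFun hs1) hE.differentiableAt, hlogE]
  ring

/-- **The logarithmic derivative of `Φ_F/Φ_G` to the right of the critical line**: for
`0 … 1/2 < re s`, `s ≠ 1`, `G(s) ≠ 0`,
`Φ_F'/Φ_F(s) − Φ_G'/Φ_G(s) = (log Q_F − log Q_G) + (∑ⱼ λⱼψ(λⱼs+μⱼ) − ∑ₖ λ'ₖψ(λ'ₖs+μ'ₖ)) − ∑ c(n) log n n^{-s}`
(the right-hand sides of (4) and of the gamma-factor terms in (7)). [cite: Soundararajan2002, (4), (7)] -/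
theorem logDeriv_completed_sub
    (hb₁ : ∀ n, ¬ IsPrimePow n → b₁ n = 0) (hO₁ : b₁ =O[atTop] fun n ↦ (n : ℝ) ^ θ₁)
    (hexp₁ : ∀ s : ℂ, 1 < s.re → cexp (LSeries b₁ s) = D₁.toFun s)
    (hb₂ : ∀ n, ¬ IsPrimePow n → b₂ n = 0) (hO₂ : b₂ =O[atTop] fun n ↦ (n : ℝ) ^ θ₂)
    (hexp₂ : ∀ s : ℂ, 1 < s.re → cexp (LSeries b₂ s) = D₂.toFun s)
    (hθ₁ : θ₁ < 1 / 2) (hθ₂ : θ₂ < 1 / 2) (hδ : 0 < δ₀)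
    (hthin : ∀ x : ℝ, 2 ≤ x →
      (Set.ncard {p : ℕ | p ∈ 𝓔 ∧ p.Prime ∧ (p : ℝ) ≤ x} : ℝ) ≤ C * x ^ (1 / 2 - δ₀))
    (hagree : ∀ p : ℕ, p.Prime → p ∉ 𝓔 → D₁.coeff p = D₂.coeff p)
    {s : ℂ} (hs : 1 / 2 < s.re) (hs1 : s ≠ 1) (hG : D₂.toFun s ≠ 0) :
    logDeriv D₁.completed s - logDeriv D₂.completed s =
      (Complex.log D₁.Q - Complex.log D₂.Q) +
        (∑ j, (D₁.lam j : ℂ) * digamma (D₁.lam j * s + D₁.mu j) -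
          ∑ j, (D₂.lam j : ℂ) * digamma (D₂.lam j * s + D₂.mu j)) -
        LSeries (LSeries.logMul (b₁ - b₂)) s := by
  have hs0 : 0 < s.re := by linarith
  obtain ⟨hF, hsub⟩ := logDeriv_toFun_sub hb₁ hO₁ hexp₁ hb₂ hO₂ hexp₂ hθ₁ hθ₂ hδ hthin hagree hs hs1 hG
  rw [D₁.logDeriv_completed hs0 hs1 hF, D₂.logDeriv_completed hs0 hs1 hG]
  linear_combination hsub

end Pair

end Soundararajan2004
namespace Soundararajan2004

/-! ### Orders of zeros: unit multiples and the reflection `s ↦ 1 - s̄` -/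

/-- If `f = g · u` near `z₀` with `u` analytic and `u(z₀) ≠ 0`, then `f` and `g` vanish to the same
order at `z₀`. [folklore] -/
theorem analyticOrderAt_eq_of_eventuallyEq_mul {f g u : ℂ → ℂ} {z₀ : ℂ}
    (hg : AnalyticAt ℂ g z₀) (hu : AnalyticAt ℂ u z₀) (hu0 : u z₀ ≠ 0)
    (hfg : f =ᶠ[𝓝 z₀] fun z ↦ g z * u z) :
    analyticOrderAt f z₀ = analyticOrderAt g z₀ := by
  rw [analyticOrderAt_congr hfg]
  have : (fun z ↦ g z * u z) = g * u := rfl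
  rw [this, analyticOrderAt_mul hg hu, hu.analyticOrderAt_eq_zero.mpr hu0, add_zero]

/-- Analyticity is preserved by the anti-holomorphic reflection in the critical line: if `g` is
analytic at `1 - conj ρ` then `s ↦ conj (g (1 - conj s))` is analytic at `ρ`. [folklore] -/
theorem analyticAt_conj_comp_one_sub_conj {g : ℂ → ℂ} {ρ : ℂ} (hg : AnalyticAt ℂ g (1 - conj ρ)) :
    AnalyticAt ℂ (fun s ↦ conj (g (1 - conj s))) ρ := by
  -- `g` is differentiable on an open neighbourhood `V` of `1 - conj ρ`
  obtain ⟨V, hVnhds, hVd⟩ : ∃ V ∈ 𝓝 (1 - conj ρ), DifferentiableOn ℂ g V := by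
    obtain ⟨V, hV, hVo, hmem⟩ := mem_nhds_iff.mp hg.eventually_analyticAt
    exact ⟨V, hVo.mem_nhds hmem, fun w hw ↦ (hV hw).differentiableAt.differentiableWithinAt⟩
  obtain ⟨W, hWV, hWo, hWmem⟩ := mem_nhds_iff.mp hVnhds
  set r : ℂ → ℂ := fun s ↦ 1 - conj s with hr
  have hrc : Continuous r := by simp only [hr]; fun_prop
  have hpre : IsOpen (r ⁻¹' W) := hWo.preimage hrc
  have hρ : ρ ∈ r ⁻¹' W := by simpa [hr] using hWmem
  refine DifferentiableOn.analyticAt (s := r ⁻¹' W) (fun s hs ↦ ?_) (hpre.mem_nhds hρ)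
  have hs' : 1 - conj s ∈ V := hWV hs
  have hd : DifferentiableAt ℂ (g ∘ fun w : ℂ ↦ 1 - w) (conj s) := by
    refine DifferentiableAt.comp (conj s) ?_ (by fun_prop)
    exact (hVd _ (by simpa using hs')).differentiableAt (hWo.mem_nhds (by simpa using hs) |> fun h ↦
      Filter.mem_of_superset h hWV)
  have := hd.conj_conj
  rw [conj_conj] at this
  exact (this.congr_of_eventuallyEq (Eventually.of_forall fun z ↦ by simp [Function.comp_def])).differentiableWithinAt

/-- **Orders of zeros are preserved by the reflection `s ↦ 1 - s̄`**: if `f` is analytic at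
`1 - conj ρ` then `s ↦ conj (f (1 - conj s))` vanishes at `ρ` to the same order as `f` at `1 - conj ρ`
(write `f(w) = (w - w₀)^n g(w)`; then `conj f(1 - s̄) = (-1)^n (s - ρ)^n conj g(1 - s̄)`). [folklore] -/
theorem analyticOrderAt_conj_comp_one_sub_conj {f : ℂ → ℂ} {ρ : ℂ} (hf : AnalyticAt ℂ f (1 - conj ρ)) :
    analyticOrderAt (fun s ↦ conj (f (1 - conj s))) ρ = analyticOrderAt f (1 - conj ρ) := by
  set w₀ : ℂ := 1 - conj ρ with hw₀
  set r : ℂ → ℂ := fun s ↦ 1 - conj s with hr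
  have hrc : Continuous r := by simp only [hr]; fun_prop
  have hrρ : r ρ = w₀ := rfl
  have htend : Tendsto r (𝓝 ρ) (𝓝 w₀) := hrρ ▸ hrc.tendsto ρ
  have hfr : AnalyticAt ℂ (fun s ↦ conj (f (1 - conj s))) ρ := analyticAt_conj_comp_one_sub_conj hf
  rcases eq_or_ne (analyticOrderAt f w₀) ⊤ with htop | hne
  · -- `f` vanishes near `w₀`, hence the reflection vanishes near `ρ`
    rw [htop, analyticOrderAt_eq_top]
    have h0 : ∀ᶠ w in 𝓝 w₀, f w = 0 := analyticOrderAt_eq_top.mp htop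
    filter_upwards [htend.eventually h0] with s hs
    simp only [hr] at hs
    simp [hs]
  · obtain ⟨n, hn⟩ := WithTop.ne_top_iff_exists.mp hne
    rw [← hn]
    obtain ⟨g, hg, hg0, hfg⟩ := (hf.analyticOrderAt_eq_natCast).mp hn.symm
    refine (hfr.analyticOrderAt_eq_natCast).mpr ⟨fun s ↦ (-1) ^ n * conj (g (1 - conj s)),
      analyticAt_const.mul (analyticAt_conj_comp_one_sub_conj hg), ?_, ?_⟩
    · simpa [hw₀] using hg0
    · filter_upwards [htend.eventually hfg] with s hs
      simp only [hr] at hs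
      rw [hs]
      simp only [smul_eq_mul, map_mul, map_pow, map_sub, map_one, conj_conj, hw₀]
      rw [show (1 - s - (1 - ρ) : ℂ) = -(s - ρ) by ring, neg_pow]
      ring

end Soundararajan2004

namespace SelbergDatum

variable (D : SelbergDatum)

/-- The gamma factor `γ(s) = Q^s ∏ⱼ Γ(λⱼ s + μⱼ)` is differentiable on `re s > 0` (no poles of
`Γ(λⱼ s + μⱼ)` there since `re (λⱼ s + μⱼ) > 0`). [folklore] -/
theorem differentiableOn_gammaFactor : DifferentiableOn ℂ D.gammaFactor {s : ℂ | 0 < s.re} := by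
  intro s hs
  have hQ : (D.Q : ℂ) ≠ 0 := D.Q_ne_zero
  have hΓd : ∀ j, DifferentiableAt ℂ (fun z : ℂ ↦ Gamma (D.lam j * z + D.mu j)) s := by
    intro j
    refine (differentiableAt_Gamma _ fun m h ↦ ?_).comp s (by fun_prop)
    have := congrArg Complex.re h
    rw [re_lam_mul_add] at this
    have h1 := D.lam_pos j; have h2 := D.mu_re_nonneg j
    have h3 : 0 < s.re := hs
    simp at this
    nlinarith
  have hdQ : DifferentiableAt ℂ (fun z : ℂ ↦ (D.Q : ℂ) ^ z) s :=
    (hasStrictDerivAt_const_cpow (Or.inl hQ)).hasDerivAt.differentiableAt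
  have hdP : DifferentiableAt ℂ (fun z : ℂ ↦ ∏ j, Gamma (D.lam j * z + D.mu j)) s := by
    have : (fun z : ℂ ↦ ∏ j, Gamma (D.lam j * z + D.mu j)) =
        ∏ j, fun z : ℂ ↦ Gamma (D.lam j * z + D.mu j) := by
      funext z; simp [Finset.prod_apply]
    rw [this]
    exact DifferentiableAt.finsetProd fun j _ ↦ hΓd j
  exact (hdQ.mul hdP).differentiableWithinAt

/-- The gamma factor is analytic on `re s > 0`. [folklore] -/
theorem analyticOnNhd_gammaFactor : AnalyticOnNhd ℂ D.gammaFactor {s : ℂ | 0 < s.re} :=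
  D.differentiableOn_gammaFactor.analyticOnNhd (isOpen_lt continuous_const continuous_re)

/-- The gamma factor does not vanish on `re s > 0`. [folklore] -/
theorem gammaFactor_ne_zero {s : ℂ} (hs : 0 < s.re) : D.gammaFactor s ≠ 0 := by
  unfold gammaFactor
  refine mul_ne_zero ?_ (Finset.prod_ne_zero_iff.mpr fun j _ ↦ D.Gamma_lam_mul_add_mu_ne_zero s hs j)
  exact (cpow_ne_zero_iff_of_exponent_ne_zero (by rintro rfl; simp at hs)).mpr D.Q_ne_zero

/-- `Φ(s) = γ(s) F(s)`. [folklore] -/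
theorem completed_eq_gammaFactor_mul (s : ℂ) : D.completed s = D.gammaFactor s * D.toFun s := rfl

end SelbergDatum

namespace Soundararajan2004

section Pair

variable {D₁ D₂ : SelbergDatum} {b₁ b₂ : ℕ → ℂ} {θ₁ θ₂ : ℝ} {𝓔 : Set ℕ} {δ₀ C : ℝ}

/-- **The zeros of `Φ_F` and `Φ_G` off the critical line coincide, with multiplicities** ("the zeros
of `F` and `G` in this region coincide (including multiplicities) … Using the functional equation it
follows that the zeros of `Φ_F(s)` and `Φ_G(s)` in `re s < 1/2` also coincide", p. 1): for `ρ` in the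
open critical strip with `re ρ ≠ 1/2`, `ord_ρ Φ_F = ord_ρ Φ_G`. To the right of the line this is
`F = G e^{E}` (`toFun_eq_mul_exp`) with the gamma factors analytic and zero-free; to the left it is
transported by `Φ(s) = ω conj Φ(1 − s̄)` (`analyticOrderAt_conj_comp_one_sub_conj`).
[cite: Soundararajan2002, p. 1] -/
theorem analyticOrderAt_completed_eq
    (hb₁ : ∀ n, ¬ IsPrimePow n → b₁ n = 0) (hO₁ : b₁ =O[atTop] fun n ↦ (n : ℝ) ^ θ₁)
    (hexp₁ : ∀ s : ℂ, 1 < s.re → cexp (LSeries b₁ s) = D₁.toFun s)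
    (hb₂ : ∀ n, ¬ IsPrimePow n → b₂ n = 0) (hO₂ : b₂ =O[atTop] fun n ↦ (n : ℝ) ^ θ₂)
    (hexp₂ : ∀ s : ℂ, 1 < s.re → cexp (LSeries b₂ s) = D₂.toFun s)
    (hθ₁ : θ₁ < 1 / 2) (hθ₂ : θ₂ < 1 / 2) (hδ : 0 < δ₀)
    (hthin : ∀ x : ℝ, 2 ≤ x →
      (Set.ncard {p : ℕ | p ∈ 𝓔 ∧ p.Prime ∧ (p : ℝ) ≤ x} : ℝ) ≤ C * x ^ (1 / 2 - δ₀))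
    (hagree : ∀ p : ℕ, p.Prime → p ∉ 𝓔 → D₁.coeff p = D₂.coeff p)
    {ρ : ℂ} (hρ₀ : 0 < ρ.re) (hρ₁ : ρ.re < 1) (hρ : ρ.re ≠ 1 / 2) :
    analyticOrderAt D₁.completed ρ = analyticOrderAt D₂.completed ρ := by
  have hab := abscissaOfAbsConv_diff_le hb₁ hO₁ hexp₁ hb₂ hO₂ hexp₂ hθ₁ hθ₂ hδ hthin hagree
  -- the right half of the strip
  have hright : ∀ w : ℂ, 1 / 2 < w.re → w.re < 1 →
      analyticOrderAt D₁.completed w = analyticOrderAt D₂.completed w := by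
    intro w hw hw1
    have hw0 : 0 < w.re := by linarith
    have hwne : w ≠ 1 := by
      rintro rfl; simp at hw1
    have hopen : IsOpen {z : ℂ | 1 / 2 < z.re ∧ z ≠ 1} :=
      (isOpen_lt continuous_const continuous_re).inter isOpen_ne
    -- `Φ₁ = Φ₂ · U` near `w`, `U = γ₁ e^{E} / γ₂`
    set U : ℂ → ℂ := fun z ↦ D₁.gammaFactor z * cexp (LSeries (b₁ - b₂) z) / D₂.gammaFactor z with hU
    have hγ₁ : AnalyticAt ℂ D₁.gammaFactor w := D₁.analyticOnNhd_gammaFactor w hw0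
    have hγ₂ : AnalyticAt ℂ D₂.gammaFactor w := D₂.analyticOnNhd_gammaFactor w hw0
    have hE : AnalyticAt ℂ (fun z ↦ cexp (LSeries (b₁ - b₂) z)) w :=
      (LSeries_analyticOnNhd (b₁ - b₂) w (hab.trans_lt (by exact_mod_cast hw))).cexp
    have hUan : AnalyticAt ℂ U w := (hγ₁.mul hE).div hγ₂ (D₂.gammaFactor_ne_zero hw0)
    have hU0 : U w ≠ 0 := by
      simp only [hU]
      exact div_ne_zero (mul_ne_zero (D₁.gammaFactor_ne_zero hw0) (Complex.exp_ne_zero _))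
        (D₂.gammaFactor_ne_zero hw0)
    have hΦ₂ : AnalyticAt ℂ D₂.completed w := D₂.analyticOnNhd_completed w ⟨hw0, hwne⟩
    refine analyticOrderAt_eq_of_eventuallyEq_mul hΦ₂ hUan hU0 ?_
    filter_upwards [hopen.mem_nhds ⟨hw, hwne⟩] with z hz
    have hz0 : 0 < z.re := by linarith [hz.1]
    rw [D₁.completed_eq_gammaFactor_mul, D₂.completed_eq_gammaFactor_mul,
      toFun_eq_mul_exp hb₁ hO₁ hexp₁ hb₂ hO₂ hexp₂ hθ₁ hθ₂ hδ hthin hagree hz.1 hz.2, hU]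
    field_simp [D₂.gammaFactor_ne_zero hz0]
  rcases lt_or_gt_of_ne hρ with hlt | hgt
  · -- the left half: reflect
    have hρne : ρ ≠ 1 := by rintro rfl; simp at hρ₁
    set ρ' : ℂ := 1 - conj ρ with hρ'
    have hρ'₀ : 1 / 2 < ρ'.re := by simp [hρ']; linarith
    have hρ'₁ : ρ'.re < 1 := by simp [hρ']; linarith
    have hstrip : IsOpen {z : ℂ | 0 < z.re ∧ z.re < 1} :=
      (isOpen_lt continuous_const continuous_re).inter (isOpen_lt continuous_re continuous_const)
    have hrefl : ∀ (D : SelbergDatum), analyticOrderAt D.completed ρ = analyticOrderAt D.completed ρ' := by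
      intro D
      have hΦan : AnalyticAt ℂ D.completed (1 - conj ρ) :=
        D.analyticOnNhd_completed _ ⟨by simp; linarith, by
          intro h; have := congrArg Complex.re h; simp at this; linarith⟩
      have hFE : D.completed =ᶠ[𝓝 ρ] fun z ↦ conj (D.completed (1 - conj z)) * D.rootNumber := by
        filter_upwards [hstrip.mem_nhds ⟨hρ₀, hρ₁⟩] with z hz
        rw [D.completed_eq z hz.1 hz.2, mul_comm]
      rw [analyticOrderAt_eq_of_eventuallyEq_mul (analyticAt_conj_comp_one_sub_conj hΦan)
        analyticAt_const D.rootNumber_ne_zero hFE]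
      exact analyticOrderAt_conj_comp_one_sub_conj hΦan
    rw [hrefl D₁, hrefl D₂]
    exact hright ρ' hρ'₀ hρ'₁
  · exact hright ρ hgt hρ₁

/-- The same for Mathlib's `meromorphicOrderAt` (the multiplicity used by the argument principle of
`Literature/Analysis/Complex/WeightedArgumentPrinciple.lean`). [cite: Soundararajan2002, p. 1] -/
theorem meromorphicOrderAt_completed_eq
    (hb₁ : ∀ n, ¬ IsPrimePow n → b₁ n = 0) (hO₁ : b₁ =O[atTop] fun n ↦ (n : ℝ) ^ θ₁)
    (hexp₁ : ∀ s : ℂ, 1 < s.re → cexp (LSeries b₁ s) = D₁.toFun s)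
    (hb₂ : ∀ n, ¬ IsPrimePow n → b₂ n = 0) (hO₂ : b₂ =O[atTop] fun n ↦ (n : ℝ) ^ θ₂)
    (hexp₂ : ∀ s : ℂ, 1 < s.re → cexp (LSeries b₂ s) = D₂.toFun s)
    (hθ₁ : θ₁ < 1 / 2) (hθ₂ : θ₂ < 1 / 2) (hδ : 0 < δ₀)
    (hthin : ∀ x : ℝ, 2 ≤ x →
      (Set.ncard {p : ℕ | p ∈ 𝓔 ∧ p.Prime ∧ (p : ℝ) ≤ x} : ℝ) ≤ C * x ^ (1 / 2 - δ₀))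
    (hagree : ∀ p : ℕ, p.Prime → p ∉ 𝓔 → D₁.coeff p = D₂.coeff p)
    {ρ : ℂ} (hρ₀ : 0 < ρ.re) (hρ₁ : ρ.re < 1) (hρ : ρ.re ≠ 1 / 2) :
    meromorphicOrderAt D₁.completed ρ = meromorphicOrderAt D₂.completed ρ := by
  have hne : ρ ≠ 1 := by rintro rfl; simp at hρ₁
  rw [(D₁.analyticOnNhd_completed ρ ⟨hρ₀, hne⟩).meromorphicOrderAt_eq,
    (D₂.analyticOnNhd_completed ρ ⟨hρ₀, hne⟩).meromorphicOrderAt_eq,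
    analyticOrderAt_completed_eq hb₁ hO₁ hexp₁ hb₂ hO₂ hexp₂ hθ₁ hθ₂ hδ hthin hagree hρ₀ hρ₁ hρ]

end Pair

end Soundararajan2004
end Literature.NumberTheory.LFunctions

end
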